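import Literature.Barriers.ValiantsHypothesis.FullRankMultilinearProofs
import Literature.Barriers.ValiantsHypothesis.FullRankMultilinearCircuit
import HarnessLib

/-!
# The full-rank / multilinear barrier, discharged: `FullRankMultilinear_holds`

`FullRankMultilinear = RazYehudayoff2008_thm42 ∧ RazYehudayoff2008_smCircuit`
(`FullRankMultilinear.lean`) — Raz's partial-derivative-matrix (full-rank) method cannot certify
`ω(n³)` syntactically multilinear circuit size, because the Raz–Yehudayoff polynomial is of full
rank over `K = F(W)` [RazYehudayoff2008, Thm. 4.2] and has a syntactically multilinear circuit of
size `O(n³)` over `K` [RazYehudayoff2008, §4.1 and Thm. 4.4(2)], [AlonKumarVolk2020, §4.1,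
closing remark] — is now a THEOREM of the tree:

* `RazYehudayoff2008_thm42_holds` (`FullRankMultilinearProofs.lean`): Lemma 4.3 by induction on
  balanced intervals (Kronecker products of coefficient matrices, specialisation of the
  auxiliary variables `ω`), then Thm. 4.2;
* `RazYehudayoff2008_smCircuit_holds` (`FullRankMultilinearCircuit.lean`): the defining
  recursion of `f` tabulated as a fan-in-two circuit with `4n³ + 2n² ≤ 6 (n³ + 1)` gates, every
  product gate multiplying polynomials of disjoint intervals.

The unconditional forms of the two corollaries of `FullRankMultilinear.lean` are recorded below.

## References

* [RazYehudayoff2008] R. Raz, A. Yehudayoff, *Balancing syntactically multilinear arithmetic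
  circuits*, Comput. Complexity 17 (2008) 515–535, §4.1, Thm. 4.2, Lemma 4.3, Thm. 4.4.
* [AlonKumarVolk2020] N. Alon, M. Kumar, B. L. Volk, *Unbalancing sets and an almost quadratic
  lower bound for syntactically multilinear arithmetic circuits*, Combinatorica 40 (2020) 149–178
  (arXiv:1708.02037), §4.1 (closing remark).
-/

noncomputable section

namespace Literature.Barriers.ValiantsHypothesis

universe u

/-- **The full-rank / multilinear barrier holds** (discharge of the barrier fact
`FullRankMultilinear` = [RazYehudayoff2008, Thm. 4.2] ∧ the `O(n³)` syntactically multilinear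
circuit of [RazYehudayoff2008, §4.1, Thm. 4.4(2)] as counted by [AlonKumarVolk2020, §4.1]): the
Raz–Yehudayoff polynomial is a full-rank polynomial over `K = F(W)` of syntactically multilinear
circuit size `O(n³)`, so "the partial derivative matrix technique cannot prove an `ω(n³)` lower
bound". [cite: AlonKumarVolk2020, §4.1 (closing remark)] [cite: RazYehudayoff2008, Thm. 4.2 and Thm. 4.4(2)] -/
theorem FullRankMultilinear_holds : FullRankMultilinear.{u} :=
  ⟨RazYehudayoff2008_thm42_holds, RazYehudayoff2008_smCircuit_holds⟩

/-- **No `ω(n³)` from full rank, unconditionally**: there is a constant `C` such that over the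
fields `K = F(W)` (every field `F`, every `n`) the full-rank method does not certify syntactically
multilinear size `> C (n³ + 1)`. [cite: AlonKumarVolk2020, §4.1 (closing remark)] -/
theorem not_fullRankMethodProves_cubic :
    ∃ C : ℕ, ∀ (F : Type u) [Field F] (n : ℕ),
      ¬ FullRankMethodProves (RYField F n) n (C * (n ^ 3 + 1)) :=
  FullRankMultilinear_holds.not_fullRankMethodProves

/-- Pointed form, unconditionally: whatever the full-rank method certifies over `K = F(W)` for all
full-rank polynomials in `2n` variables is at most `C (n³ + 1)`.
[cite: AlonKumarVolk2020, §4.1 (closing remark)] -/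
theorem fullRankMethodProves_le_cubic :
    ∃ C : ℕ, ∀ (F : Type u) [Field F] (n s : ℕ),
      FullRankMethodProves (RYField F n) n s → s ≤ C * (n ^ 3 + 1) :=
  FullRankMultilinear_holds.le_of_fullRankMethodProves

end Literature.Barriers.ValiantsHypothesis
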